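import Literature.NumberTheory.Transcendental.KaehlerHodgeDecompositionProofs
import Literature.NumberTheory.Transcendental.KaehlerHodgeTypeProofs
import HarnessLib

/-!
# Harmonic Hodge decomposition `ℋᵏ_ℂ = ⨆ ℋ^{p,q}_{∂̄}`: reduction to the Kähler identity (Voisin 2002, Cor. 6.10)

Theorems-only companion of `Literature/NumberTheory/Transcendental/KaehlerHodge.lean` (C12), of
`KaehlerHodgeDecompositionProofs.lean` (the assembly
`charmonicForms_eq_iSup_dolbeaultHarmonicForms_of_facts` of Voisin's proof of Cor. 6.10 from two
hypotheses, Thm. 6.7 and Cor. 6.9) and of `KaehlerHodgeTypeProofs.lean`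
(`typeComponent_mem_charmonicForms_of_kaehlerIdentity`, Cor. 6.9 from Thm. 6.7 on a complex manifold).

`KaehlerHodge.lean` records Voisin's Corollary 6.10 (Hodge Theory and Complex Algebraic Geometry I,
§6.1.2, p. 142: on a Kähler manifold "`ℋᵏ(X) = ⨁_{p+q=k} ℋ^{p,q}`, where `ℋ^{p,q}` is the set of forms
of type `(p,q)` which are harmonic for `Δ_d`. By theorem 6.7, this is also the set of forms of type
`(p,q)` which are harmonic for `Δ_∂̄`"; Huybrechts (2005), Prop. 3.2.6 (ii), `X` not necessarily
compact) as the predicate `Literature.NumberTheory.Transcendental.charmonicForms_eq_iSup_dolbeaultHarmonicForms g o`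
(`ℋᵏ_ℂ = ⨆_{p+q=k} ℋ^{p,q}_{∂̄}` for the smooth metric `g`, if `g` is Kähler). This file records the two
elementary facts found on review of that statement (2026-08-15):

* §1 (any atlas, pure lattice algebra): in each degree the predicate contains
  `dolbeaultHarmonicForms_le_charmonicForms g o` (`ℋ^{p,q}_{∂̄} ≤ ℋᵏ_ℂ`), since `ℋ^{p,q}_{∂̄}` is one of
  the summands when `p + q = k` and is `⊥` otherwise (`dolbeaultHarmonicForms_eq_bot_of_ne`). This is the
  lever of the refutation of the universal closure of the predicate over its elaborated binders, which
  omit the holomorphic atlas (`KaehlerHodgeDecompositionCounterexample.lean`, filed separately, on the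
  rigged torus of `KaehlerHodgeHarmonicCounterexample.lean`).
* §2 (complex manifold, `[IsManifold 𝓘(ℂ, E) ω M]`): the predicate follows in one line from the
  corrected Kähler identity `cHodgeLaplacian_eq_two_smul_dolbeaultLaplacian_of_isManifold_complex g o`
  (Voisin, Thm. 6.7, `Δ_d = 2Δ_∂̄`; an existing named fact of `KaehlerHodge.lean`, not yet discharged):
  feed it to `typeComponent_mem_charmonicForms_of_kaehlerIdentity` (Cor. 6.9) and both to the assembly
  `charmonicForms_eq_iSup_dolbeaultHarmonicForms_of_facts` (Cor. 6.10). Hence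
  `charmonicForms_eq_iSup_dolbeaultHarmonicForms g o` holds at every complex manifold as soon as
  `cHodgeLaplacian_eq_two_smul_dolbeaultLaplacian_of_isManifold_complex_holds` lands — the statement is a
  corollary of that one deep fact, not an independent one (D-0026: no further named fact is introduced,
  and none is needed).

## References

* C. Voisin, *Hodge Theory and Complex Algebraic Geometry I*, Cambridge Studies in Advanced
  Mathematics 76 (2002), §6.1.1 (Prop. 6.5), §6.1.2: Thm. 6.7 (p. 141), Cor. 6.8, 6.9, 6.10 (p. 142).
  [Voisin2002]
* D. Huybrechts, *Complex Geometry* (2005), Prop. 3.1.12 (iii) (Kähler identities), Prop. 3.2.6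
  (harmonic forms by bidegree; (ii) the Kähler case).
-/

noncomputable section

open scoped Manifold ContDiff
open Bundle Module Finset

namespace Literature.NumberTheory.Transcendental

/-! ### §1 `ℋᵏ_ℂ = ⨆ ℋ^{p,q}_{∂̄}` contains `ℋ^{p,q}_{∂̄} ≤ ℋᵏ_ℂ` (any atlas) -/

section AnyAtlas

variable {E : Type*} [NormedAddCommGroup E] [NormedSpace ℂ E]
  {M : Type*} [TopologicalSpace M] [ChartedSpace E M] {k m : ℕ}
  [FiniteDimensional ℂ E] {n : ℕ} [Fact (finrank ℝ E = n)] [IsManifold 𝓘(ℝ, E) ∞ M]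
  (g : ContMDiffRiemannianMetric 𝓘(ℝ, E) ∞ E (fun x : M ↦ TangentSpace 𝓘(ℝ, E) x))
  (o : (x : M) → Orientation ℝ (TangentSpace 𝓘(ℝ, E) x) (Fin n))

/-- **`ℋᵏ_ℂ = ⨆_{p+q=k} ℋ^{p,q}_{∂̄}` implies `ℋ^{p,q}_{∂̄} ≤ ℋᵏ_ℂ`**, degree by degree and for every
atlas, metric term `g` and orientation family `o` (no complex-manifold hypothesis: pure lattice
algebra): for `p + q = k` the space `dolbeaultHarmonicForms o p q h` is one of the summands of the
supremum, and for `p + q ≠ k` it is `⊥` (`dolbeaultHarmonicForms_eq_bot_of_ne`). In Voisin (2002),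
§6.1.2 this is the containment `ℋ^{p,q} ⊂ ℋᵏ(X)` implicit in Cor. 6.10. [cite: Voisin2002, §6.1.2 Cor. 6.10, p. 142] -/
theorem dolbeaultHarmonicForms_le_charmonicForms_of_eq_iSup
    (H : charmonicForms_eq_iSup_dolbeaultHarmonicForms (k := k) (m := m) g o) :
    dolbeaultHarmonicForms_le_charmonicForms (k := k) (m := m) g o := by
  intro hg h p q
  letI : RiemannianBundle (fun x : M ↦ TangentSpace 𝓘(ℝ, E) x) := ⟨g.toRiemannianMetric⟩
  intro ho
  by_cases hpq : p + q = k
  · rw [H hg h ho]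
    intro α hα
    exact Submodule.mem_iSup_of_mem (p, q) (Submodule.mem_iSup_of_mem (mem_antidiagonal.mpr hpq) hα)
  · rw [dolbeaultHarmonicForms_eq_bot_of_ne o hpq h]
    exact bot_le

end AnyAtlas

/-! ### §2 The decomposition from the Kähler identity on a complex manifold -/

section Complex

variable {E : Type*} [NormedAddCommGroup E] [NormedSpace ℂ E]
  {M : Type*} [TopologicalSpace M] [ChartedSpace E M] {k m : ℕ}
  [FiniteDimensional ℂ E] {n : ℕ} [Fact (finrank ℝ E = n)]
  [IsManifold 𝓘(ℂ, E) ω M] [IsManifold 𝓘(ℝ, E) ∞ M]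
  (g : ContMDiffRiemannianMetric 𝓘(ℝ, E) ∞ E (fun x : M ↦ TangentSpace 𝓘(ℝ, E) x))
  (o : (x : M) → Orientation ℝ (TangentSpace 𝓘(ℝ, E) x) (Fin n))

/-- **Harmonic Hodge decomposition from the Kähler identity** (Voisin (2002), §6.1.2, Cor. 6.10
deduced from Thm. 6.7; Huybrechts (2005), Prop. 3.2.6 (ii) deduced from Prop. 3.1.12): on a *complex*
manifold `M` (holomorphic atlas `[IsManifold 𝓘(ℂ, E) ω M]`, a hypothesis of this theorem) with a smooth
Riemannian metric `g` and an orientation family `o`, the predicate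
`charmonicForms_eq_iSup_dolbeaultHarmonicForms g o` in degrees `k + m = n` — if `g` is Kähler and the
volume form of `o` is smooth, `ℋᵏ_ℂ = ⨆_{p+q=k} ℋ^{p,q}_{∂̄}` — follows from the corrected Kähler identity
`cHodgeLaplacian_eq_two_smul_dolbeaultLaplacian_of_isManifold_complex g o` (`Δ_d = 2Δ_∂̄` on smooth
forms, Thm. 6.7) in the same degrees: the identity gives type preservation of `Δ_d`
(`typeComponent_mem_charmonicForms_of_kaehlerIdentity`, Cor. 6.9), and the two feed Voisin's assembly
`charmonicForms_eq_iSup_dolbeaultHarmonicForms_of_facts` (at a complex manifold the corrected identity is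
definitionally the `Prop` that assembly expects, `cHodgeLaplacian_eq_two_smul_dolbeaultLaplacian_of_isManifold_complex_iff`).
So the statement is discharged at every complex manifold by
`cHodgeLaplacian_eq_two_smul_dolbeaultLaplacian_of_isManifold_complex_holds` as soon as that lands.
[cite: Voisin2002, §6.1.2 Thm. 6.7 and Cor. 6.10, pp. 141–142] -/
theorem charmonicForms_eq_iSup_dolbeaultHarmonicForms_of_kaehlerIdentity
    (hK : cHodgeLaplacian_eq_two_smul_dolbeaultLaplacian_of_isManifold_complex (k := k) (m := m) g o) :
    charmonicForms_eq_iSup_dolbeaultHarmonicForms (k := k) (m := m) g o :=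
  charmonicForms_eq_iSup_dolbeaultHarmonicForms_of_facts g o hK
    (typeComponent_mem_charmonicForms_of_kaehlerIdentity g o hK)

end Complex

end Literature.NumberTheory.Transcendental
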